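import Summits.AnomalousDissipation.AnomalousDissipation.Theorems.SolenoidalFractalHomogenisationLagrangianStepDefs
import Summits.AnomalousDissipation.AnomalousDissipation.Theorems.SolenoidalFractalHomogenisationLagrangianRenormalisationStepExistsL
import Literature.Analysis.FluidPDE.PassiveVectorTensorEnergyDecay
import HarnessLib

/-!
# K1L `LagrangianRenormalisationStep` (stmt-AnomalousDissipation-24912), skeleton of record `Lines/onelevel.lean`: the stub `stub_baseT` BY NAME

**Base of the cascade.**  For an L-permissible, regular Lagrangian lattice carrier `E`, a level `m`, a constant fourth-order viscosity
tensor `𝔸` in a Legendre–Hadamard window `NearIso 𝔸 lo hi` with `0 < lo`, and an admissible datum `w₀` (`H¹`, mean zero, weakly divergence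
free), EVERY weak tensor-class solution `u` of the level-`m` truncated problem (`TSol E m 𝔸 w₀ u`, i.e.
`IsWeakTensorPassiveVectorOn 0 1 𝔸 (E.partialSum m) w₀ u`) has dropped at least the fraction `1 − e^{−4π² lo}` of the initial energy by
a.e. time `t ∈ (1/2, 1)`:  `(1 − exp(−4π² lo)) ‖w₀‖² ≤ drop w₀ u t = ‖w₀‖² − ‖u(t)‖²`.

Proof (all inputs landed): the amended `Regular` (planner ruling R22-1, p610969) gives jointly continuous levels
(`LevelRegular.continuous_uncurry_b`), hence a jointly continuous partial sum with essentially bounded space–time lift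
(`LagrangianRenormalisationStep.continuous_uncurry_partialSum`, `…memLp_top_stLift_of_continuous`, p610252); the tensor energy road of the
cell's literature lane (E1–E5, `PassiveVectorTensorEnergyDecay`, p611023) gives, for every weak solution along an `L^∞` carrier and mean-zero
`L²` divergence-free datum, `∫‖u t‖² ≤ exp(−8π² lo t) ∫‖w₀‖²` for a.e. `t ∈ (0,1)` (`IsWeakTensorPassiveVectorOn.ae_integral_norm_sq_le_exp`:
modewise energy identity, coercivity `Re⟪X, T_𝔸(k) X⟫ ≥ lo|k|²|X|²`, Poincaré `|k| ≥ 1` off the conserved zero mode); finally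
`exp(−8π² lo t) ≤ exp(−4π² lo)` for `t ≥ 1/2` (`drop_lower_of_weighted_decay`).  The theorem carries the REGISTERED signature textually
over the shared definitions `LagrangianStep.{VF, IsDatum, TSol, drop}` (p610007).

No definitions, no named facts, no sorry; rung-leaf bookkeeping only (nothing about Onsager's conjecture or anomalous dissipation in general
is claimed).  Prover seat `ad-solenoidal-k2r-lowerlaw-p1` g5, 2026-08-28.
-/

set_option linter.dupNamespace false

noncomputable section

namespace Summit.AnomalousDissipation.AnomalousDissipation.Theorems.SolenoidalFractalHomogenisation.LagrangianStep

open Literature.Analysis Literature.Analysis.FluidPDE Literature.Analysis.FunctionSpaces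
open MeasureTheory Set Filter Function
open scoped ENNReal NNReal InnerProductSpace

/-- **Real-arithmetic core of the base step.**  From the decay `e(t) ≤ exp(−8π² lo t) · E₀` for a.e. `t ∈ (0,1)` (`E₀ ≥ 0`) to the
drop bound `(1 − exp(−4π² lo)) · E₀ ≤ E₀ − e(t)` for a.e. `t ∈ (1/2, 1)`. [folklore] -/
theorem drop_lower_of_decay {E₀ lo : ℝ} {e : ℝ → ℝ} (hlo : 0 ≤ lo) (hE₀ : 0 ≤ E₀)
    (h : ∀ᵐ t ∂(volume.restrict (Ioo (0:ℝ) 1)), e t ≤ Real.exp (-(8 * Real.pi ^ 2 * lo * t)) * E₀) :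
    ∀ᵐ t ∂(volume.restrict (Ioo (1/2 : ℝ) 1)), (1 - Real.exp (-(4 * Real.pi ^ 2 * lo))) * E₀ ≤ E₀ - e t := by
  have hsub : Ioo (1/2 : ℝ) 1 ⊆ Ioo (0:ℝ) 1 := Ioo_subset_Ioo (by norm_num) le_rfl
  have h' : ∀ᵐ t ∂(volume.restrict (Ioo (1/2 : ℝ) 1)), e t ≤ Real.exp (-(8 * Real.pi ^ 2 * lo * t)) * E₀ :=
    ae_restrict_of_ae_restrict_of_subset hsub h
  have hmem : ∀ᵐ t ∂(volume.restrict (Ioo (1/2 : ℝ) 1)), t ∈ Ioo (1/2 : ℝ) 1 := ae_restrict_mem measurableSet_Ioo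
  filter_upwards [h', hmem] with t ht htI
  have h2 : Real.exp (-(8 * Real.pi ^ 2 * lo * t)) ≤ Real.exp (-(4 * Real.pi ^ 2 * lo)) := by
    apply Real.exp_le_exp.mpr
    have hπ : 0 ≤ Real.pi ^ 2 * lo := by positivity
    nlinarith [htI.1]
  nlinarith [mul_le_mul_of_nonneg_right h2 hE₀]

/-- **Registered stub `stub_baseT` of crux K1L `LagrangianRenormalisationStep` (skeleton of record `Lines/onelevel.lean`), by name and
signature.**  A coercive constant-tensor problem (`NearIso 𝔸 lo hi`, `0 < lo`) along the partial sum `b 1 + ⋯ + b m` of an L-permissible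
regular Lagrangian lattice carrier drops at least `(1 − e^{−4π² lo})·‖w₀‖²` of the energy of every admissible datum by a.e. `t ∈ (1/2, 1)`,
for EVERY weak solution in the tensor class (energy road E1–E5 of `PassiveVectorTensor*` + Poincaré on mean-zero fields; the carrier enters
only through its `L^∞` bound, supplied by `Regular ⊇ LevelRegular`). [cite: ArmstrongVicol2025, §5.4 (the base case of the cascade: Poincaré at the bottom level)] -/
theorem stub_baseT : ∀ k (E : LatticeShear.LagrangianLatticeCarrier k), E.LPermissible → E.Regular →
    ∀ (m : ℕ) (𝔸 : Torus.Visc4 (Fin 3)) (lo hi : ℝ), 0 < lo → Torus.NearIso 𝔸 lo hi →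
      ∀ (w₀ : VF) (u : ℝ → VF), IsDatum w₀ → TSol E m 𝔸 w₀ u →
        ∀ᵐ t ∂(volume.restrict (Ioo (1/2 : ℝ) 1)),
          (1 - Real.exp (-(4 * Real.pi ^ 2 * lo))) * Torus.vectorL2Sq w₀ ≤ drop w₀ u t := by
  intro k E _hP hR m 𝔸 lo hi hlo hNI w₀ u hd hu
  -- the partial sum is jointly continuous (amended `Regular` ⊇ `LevelRegular`, R22-1), hence essentially bounded on `(0,1) × 𝕋³`
  have hc : ∀ i < m, Continuous (uncurry (E.b (i + 1))) := fun i _ => hR.levelRegular.continuous_uncurry_b i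
  have hb : MemLp (FunctionSpaces.Torus.stLift (E.partialSum m)) ∞
      (volume.restrict (Ioo 0 1 ×ˢ (univ : Set (EuclideanSpace ℝ (Fin 3))))) :=
    LagrangianRenormalisationStep.memLp_top_stLift_of_continuous
      (LagrangianRenormalisationStep.continuous_uncurry_partialSum E m hc) 1
  -- the datum: `H¹ ⇒ L²`, mean zero, weakly divergence free
  obtain ⟨hH1, hmean, hdiv⟩ := hd
  have hw₀ : MemLp w₀ 2 volume := RealisedQuasiStaticCellLaw.memLp_two_of_memSobolev_one_complexify hH1
  -- energy decay of every weak tensor-class solution along an `L^∞` carrier (E5)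
  have hdecay := Torus.IsWeakTensorPassiveVectorOn.ae_integral_norm_sq_le_exp hu hNI hlo hw₀ hdiv hmean hb
  -- real arithmetic on `(1/2, 1)`
  have hE₀ : 0 ≤ Torus.vectorL2Sq w₀ := integral_nonneg fun x => by positivity
  exact drop_lower_of_decay hlo.le hE₀ hdecay

end Summit.AnomalousDissipation.AnomalousDissipation.Theorems.SolenoidalFractalHomogenisation.LagrangianStep

end
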